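import Summits.AtomisticToContinuum.FouriersLaw.Theorems.ContactStieltjesMeasureStieltjesRepresentationPencilIdentities
import Summits.AtomisticToContinuum.FouriersLaw.Theorems.ContactStieltjesMeasureStieltjesRepresentationPencilCross

/-!
# Stub `stub_pencilOfGreenKubo` of line `cayley-pencil` (crux `ContactStieltjesMeasure.StieltjesRepresentation`,
# stmt-AtomisticToContinuum-15248), part 5b: adjointness (A₀) and the cross-friction identity (C₀)

Helper file (`--supports stmt-AtomisticToContinuum-15248`), sequel of part 5a (energy identities) and part 4b (cross pairing).
Pinned anharmonic chain `P_γ = pinnedChain ω₂ lam β γ` (`ω₂ > 0`, `lam, β ≥ 0`), `N ≥ 2`, `T > 0`, `ρ = e^{-H/T}`; nice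
fields `F, F'` with adjoint fields `v = D*F`, `v' = D*F'` (`D = √T(∂_{p_0}, ∂_{p_{N-1}})`); forward Poisson solutions
`L_γ w = -v` and adjoint Poisson solutions `w' = w̃∘Θ`, `L_γ w̃ = -(v'∘Θ)`, all smooth and `O(e^{H/(8T)})`.

* `adjoint_identity` — (A₀) `Σ_b ∫ (√T∂_{p_b}w)·F'_b ρ = Σ_b ∫ F_b·(√T∂_{p_b}w') ρ`: both sides are `∫ w v' ρ = ∫ v w' ρ`
  (Gibbs integration by parts, part 2), equal by the cross pairing at equal frictions (part 4b).
* `cross_identity` — (C₀) for forward solutions `w_a` at friction `γ` and `w_c` at friction `γ'` of the SAME source `v`, and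
  the adjoint solution `w'` at friction `γ` of `v'`:
  `Σ_b ∫ (√T∂_bw_a - √T∂_bw_c)·F'_b ρ = (γ' - γ) Σ_b ∫ (√T∂_bw_c)(√T∂_bw') ρ` (part 4b at `(γ, γ)` and at `(γ, γ')`).
With (E₀), (E₀') of part 5a these are the four hypotheses of the abstract extension lemma (part 1), up to `Z⁻¹`. No definitions.
-/

noncomputable section

open MeasureTheory Filter Topology Set Function
open scoped ContDiff
open Literature.MathematicalPhysics.KineticTheory.HeatConduction

namespace Summit.AtomisticToContinuum.FouriersLaw.Theorems.ContactStieltjesMeasure.CayleyPencil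

namespace Pencil

variable {N : ℕ}

section Pinned

variable {ω₂ lam β : ℝ} (hω : 0 < ω₂) (hl : 0 ≤ lam) (hβ : 0 ≤ β) (hN : 2 ≤ N) {T : ℝ} (hT : 0 < T)
include hω hl hβ hN hT

/-- **`Σ_b √T ∫ (∂_{p_b} w)·G_b ρ = ∫ w·v_G ρ`**: pairing a Poisson-class `w` (smooth, `O(e^{H/(8T)})`, finite bath Dirichlet
forms) with a nice field `G` through `D` is pairing `w` with the adjoint field `v_G = D*G`. [folklore] -/
theorem sum_integral_partialP_mul_eq (γ : ℝ) {G₀ G₁ u w : PhaseSpace N → ℝ} (hG₀ : ContDiff ℝ ∞ G₀)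
    (hG₁ : ContDiff ℝ ∞ G₁) {A : ℝ} (hA : 0 ≤ A)
    (hb : ∀ y, |G₀ y| ≤ A * Real.exp ((pinnedChain ω₂ lam β γ).hamiltonian N y / (16 * T)) ∧
      |partialP ⟨0, by omega⟩ G₀ y| ≤ A * Real.exp ((pinnedChain ω₂ lam β γ).hamiltonian N y / (16 * T)) ∧
      |G₁ y| ≤ A * Real.exp ((pinnedChain ω₂ lam β γ).hamiltonian N y / (16 * T)) ∧
      |partialP ⟨N - 1, by omega⟩ G₁ y| ≤ A * Real.exp ((pinnedChain ω₂ lam β γ).hamiltonian N y / (16 * T)))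
    (hu : ∀ x, u x = Real.sqrt T * (-partialP ⟨0, by omega⟩ G₀ x + x.2 ⟨0, by omega⟩ * G₀ x / T) +
      Real.sqrt T * (-partialP ⟨N - 1, by omega⟩ G₁ x + x.2 ⟨N - 1, by omega⟩ * G₁ x / T))
    (hw : ContDiff ℝ ∞ w) {K : ℝ}
    (hwb : ∀ y, |w y| ≤ K * Real.exp ((pinnedChain ω₂ lam β γ).hamiltonian N y / (8 * T)))
    (hD₀ : Integrable fun x => (partialP ⟨0, by omega⟩ w x) ^ 2 * (pinnedChain ω₂ lam β γ).gibbsDensity N T x)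
    (hD₁ : Integrable fun x => (partialP ⟨N - 1, by omega⟩ w x) ^ 2 * (pinnedChain ω₂ lam β γ).gibbsDensity N T x) :
    (∫ x, (Real.sqrt T * partialP ⟨0, by omega⟩ w x) * G₀ x * (pinnedChain ω₂ lam β γ).gibbsDensity N T x) +
        ∫ x, (Real.sqrt T * partialP ⟨N - 1, by omega⟩ w x) * G₁ x * (pinnedChain ω₂ lam β γ).gibbsDensity N T x =
      ∫ x, w x * u x * (pinnedChain ω₂ lam β γ).gibbsDensity N T x := by
  set P := pinnedChain ω₂ lam β γ with hP
  set ρ := P.gibbsDensity N T with hρ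
  set b₀ : Fin N := ⟨0, by omega⟩ with hb₀
  set b₁ : Fin N := ⟨N - 1, by omega⟩ with hb₁
  obtain ⟨-, j₀, e₀⟩ := integral_mul_partialP_mul_gibbsDensity_nice hω hl hβ hT b₀ hG₀ hw hA (fun y => (hb y).1)
    (fun y => (hb y).2.1) hwb hD₀
  obtain ⟨-, j₁, e₁⟩ := integral_mul_partialP_mul_gibbsDensity_nice hω hl hβ hT b₁ hG₁ hw hA (fun y => (hb y).2.2.1)
    (fun y => (hb y).2.2.2) hwb hD₁
  have e : ∀ x, w x * u x * ρ x = Real.sqrt T * ((-partialP b₀ G₀ x + x.2 b₀ * G₀ x / T) * w x * ρ x) +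
      Real.sqrt T * ((-partialP b₁ G₁ x + x.2 b₁ * G₁ x / T) * w x * ρ x) := fun x => by rw [hu x]; ring
  simp_rw [e]
  rw [integral_add (j₀.const_mul _) (j₁.const_mul _), integral_const_mul, integral_const_mul, ← e₀, ← e₁,
    ← integral_const_mul, ← integral_const_mul]
  congr 1 <;> exact integral_congr_ae (Eventually.of_forall fun x => by ring)

/-- **(A₀) Mutual adjointness.** For nice fields `F, F'` with adjoint fields `v, v'`, a forward solution `w`
(`L_γ w = -v`) and an adjoint solution `w' = w̃∘Θ` (`L_γ w̃ = -(v'∘Θ)`), all smooth `O(e^{H/(8T)})`, `γ > 0`: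
`Σ_b ∫ (√T∂_{p_b}w)·F'_b ρ = Σ_b ∫ F_b·(√T∂_{p_b}w') ρ`. [folklore] -/
theorem adjoint_identity {γ : ℝ} (hγ : 0 < γ) {F₀ F₁ v F'₀ F'₁ v' w wt : PhaseSpace N → ℝ}
    (hF₀ : ContDiff ℝ ∞ F₀) (hF₁ : ContDiff ℝ ∞ F₁) (hF'₀ : ContDiff ℝ ∞ F'₀) (hF'₁ : ContDiff ℝ ∞ F'₁)
    {A A' : ℝ} (hA : 0 ≤ A) (hA' : 0 ≤ A')
    (hb : ∀ y, |F₀ y| ≤ A * Real.exp ((pinnedChain ω₂ lam β γ).hamiltonian N y / (16 * T)) ∧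
      |partialP ⟨0, by omega⟩ F₀ y| ≤ A * Real.exp ((pinnedChain ω₂ lam β γ).hamiltonian N y / (16 * T)) ∧
      |F₁ y| ≤ A * Real.exp ((pinnedChain ω₂ lam β γ).hamiltonian N y / (16 * T)) ∧
      |partialP ⟨N - 1, by omega⟩ F₁ y| ≤ A * Real.exp ((pinnedChain ω₂ lam β γ).hamiltonian N y / (16 * T)))
    (hb' : ∀ y, |F'₀ y| ≤ A' * Real.exp ((pinnedChain ω₂ lam β γ).hamiltonian N y / (16 * T)) ∧
      |partialP ⟨0, by omega⟩ F'₀ y| ≤ A' * Real.exp ((pinnedChain ω₂ lam β γ).hamiltonian N y / (16 * T)) ∧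
      |F'₁ y| ≤ A' * Real.exp ((pinnedChain ω₂ lam β γ).hamiltonian N y / (16 * T)) ∧
      |partialP ⟨N - 1, by omega⟩ F'₁ y| ≤ A' * Real.exp ((pinnedChain ω₂ lam β γ).hamiltonian N y / (16 * T)))
    (hv : ∀ x, v x = Real.sqrt T * (-partialP ⟨0, by omega⟩ F₀ x + x.2 ⟨0, by omega⟩ * F₀ x / T) +
      Real.sqrt T * (-partialP ⟨N - 1, by omega⟩ F₁ x + x.2 ⟨N - 1, by omega⟩ * F₁ x / T))
    (hv' : ∀ x, v' x = Real.sqrt T * (-partialP ⟨0, by omega⟩ F'₀ x + x.2 ⟨0, by omega⟩ * F'₀ x / T) +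
      Real.sqrt T * (-partialP ⟨N - 1, by omega⟩ F'₁ x + x.2 ⟨N - 1, by omega⟩ * F'₁ x / T))
    (hw : ContDiff ℝ ∞ w) (hwt : ContDiff ℝ ∞ wt) {K K' : ℝ}
    (hwb : ∀ y, |w y| ≤ K * Real.exp ((pinnedChain ω₂ lam β γ).hamiltonian N y / (8 * T)))
    (hwtb : ∀ y, |wt y| ≤ K' * Real.exp ((pinnedChain ω₂ lam β γ).hamiltonian N y / (8 * T)))
    (hLw : ∀ x, (pinnedChain ω₂ lam β γ).generator N T T w x = -v x)
    (hLwt : ∀ x, (pinnedChain ω₂ lam β γ).generator N T T wt x = -v' (x.1, -x.2)) :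
    (∫ x, (Real.sqrt T * partialP ⟨0, by omega⟩ w x) * F'₀ x * (pinnedChain ω₂ lam β γ).gibbsDensity N T x) +
        ∫ x, (Real.sqrt T * partialP ⟨N - 1, by omega⟩ w x) * F'₁ x * (pinnedChain ω₂ lam β γ).gibbsDensity N T x =
      (∫ x, F₀ x * (Real.sqrt T * partialP ⟨0, by omega⟩ (fun y : PhaseSpace N => wt (y.1, -y.2)) x) *
          (pinnedChain ω₂ lam β γ).gibbsDensity N T x) +
        ∫ x, F₁ x * (Real.sqrt T * partialP ⟨N - 1, by omega⟩ (fun y : PhaseSpace N => wt (y.1, -y.2)) x) *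
          (pinnedChain ω₂ lam β γ).gibbsDensity N T x := by
  set P := pinnedChain ω₂ lam β γ with hP
  set ρ := P.gibbsDensity N T with hρ
  set w' : PhaseSpace N → ℝ := fun x => wt (x.1, -x.2) with hw'
  obtain ⟨hvs, -, ⟨Av, hAv, hvb, -⟩, -, -⟩ := adjointField_nice hω hl hβ hN hT γ hF₀ hF₁ hA hb hv
  obtain ⟨hv's, -, ⟨Av', hAv', hv'b, -⟩, -, -⟩ := adjointField_nice hω hl hβ hN hT γ hF'₀ hF'₁ hA' hb' hv'
  obtain ⟨hD₀, hD₁, -⟩ := energy_identity hω hl hβ hN hT hγ hF₀ hF₁ hA hb hv hw hwb hLw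
  obtain ⟨hw's, hw'b, hadjeq, hD'₀, hD'₁, -⟩ :=
    energy_identity_adjoint hω hl hβ hN hT hγ hF'₀ hF'₁ hA' hb' hv' hwt hwtb hLwt
  -- both sides are pairings with the adjoint fields
  have hL := sum_integral_partialP_mul_eq hω hl hβ hN hT γ hF'₀ hF'₁ hA' hb' hv' hw hwb hD₀ hD₁
  have hR := sum_integral_partialP_mul_eq hω hl hβ hN hT γ hF₀ hF₁ hA hb hv hw's hw'b hD'₀ hD'₁
  have hR' : (∫ x, F₀ x * (Real.sqrt T * partialP ⟨0, by omega⟩ w' x) * ρ x) +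
      ∫ x, F₁ x * (Real.sqrt T * partialP ⟨N - 1, by omega⟩ w' x) * ρ x = ∫ x, w' x * v x * ρ x := by
    rw [← hR]
    congr 1 <;> exact integral_congr_ae (Eventually.of_forall fun x => by ring)
  rw [hL, hR']
  -- the cross pairing at equal frictions
  have hc := cross_pairing hω hl hβ hN hT hγ.le γ (w := w) (v := v) (w' := w') (v' := v') hw hw's hvs.continuous
    hv's.continuous hLw hadjeq hwb hvb hw'b hv'b hD₀ hD₁ hD'₀ hD'₁
  rw [sub_self, zero_mul, zero_mul, add_zero] at hc
  rw [hc]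
  exact integral_congr_ae (Eventually.of_forall fun x => by ring)

/-- **(C₀) The cross-friction identity.** For nice fields `F, F'` with adjoint fields `v, v'`, forward solutions `w_a`
at friction `γ` and `w_c` at friction `γ'` of the same source `v`, and the adjoint solution `w' = w̃∘Θ` at friction `γ`
of `v'` (all smooth `O(e^{H/(8T)})`, `γ, γ' > 0`):
`Σ_b ∫ (√T∂_bw_a - √T∂_bw_c)·F'_b ρ = (γ' - γ) Σ_b ∫ (√T∂_bw_c)(√T∂_bw') ρ`. [folklore] -/
theorem cross_identity {γ γ' : ℝ} (hγ : 0 < γ) (hγ' : 0 < γ') {F₀ F₁ v F'₀ F'₁ v' wa wc wt : PhaseSpace N → ℝ}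
    (hF₀ : ContDiff ℝ ∞ F₀) (hF₁ : ContDiff ℝ ∞ F₁) (hF'₀ : ContDiff ℝ ∞ F'₀) (hF'₁ : ContDiff ℝ ∞ F'₁)
    {A A' : ℝ} (hA : 0 ≤ A) (hA' : 0 ≤ A')
    (hb : ∀ y, |F₀ y| ≤ A * Real.exp ((pinnedChain ω₂ lam β γ).hamiltonian N y / (16 * T)) ∧
      |partialP ⟨0, by omega⟩ F₀ y| ≤ A * Real.exp ((pinnedChain ω₂ lam β γ).hamiltonian N y / (16 * T)) ∧
      |F₁ y| ≤ A * Real.exp ((pinnedChain ω₂ lam β γ).hamiltonian N y / (16 * T)) ∧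
      |partialP ⟨N - 1, by omega⟩ F₁ y| ≤ A * Real.exp ((pinnedChain ω₂ lam β γ).hamiltonian N y / (16 * T)))
    (hb' : ∀ y, |F'₀ y| ≤ A' * Real.exp ((pinnedChain ω₂ lam β γ).hamiltonian N y / (16 * T)) ∧
      |partialP ⟨0, by omega⟩ F'₀ y| ≤ A' * Real.exp ((pinnedChain ω₂ lam β γ).hamiltonian N y / (16 * T)) ∧
      |F'₁ y| ≤ A' * Real.exp ((pinnedChain ω₂ lam β γ).hamiltonian N y / (16 * T)) ∧
      |partialP ⟨N - 1, by omega⟩ F'₁ y| ≤ A' * Real.exp ((pinnedChain ω₂ lam β γ).hamiltonian N y / (16 * T)))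
    (hv : ∀ x, v x = Real.sqrt T * (-partialP ⟨0, by omega⟩ F₀ x + x.2 ⟨0, by omega⟩ * F₀ x / T) +
      Real.sqrt T * (-partialP ⟨N - 1, by omega⟩ F₁ x + x.2 ⟨N - 1, by omega⟩ * F₁ x / T))
    (hv' : ∀ x, v' x = Real.sqrt T * (-partialP ⟨0, by omega⟩ F'₀ x + x.2 ⟨0, by omega⟩ * F'₀ x / T) +
      Real.sqrt T * (-partialP ⟨N - 1, by omega⟩ F'₁ x + x.2 ⟨N - 1, by omega⟩ * F'₁ x / T))
    (hwa : ContDiff ℝ ∞ wa) (hwc : ContDiff ℝ ∞ wc) (hwt : ContDiff ℝ ∞ wt) {Ka Kc K' : ℝ}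
    (hwab : ∀ y, |wa y| ≤ Ka * Real.exp ((pinnedChain ω₂ lam β γ).hamiltonian N y / (8 * T)))
    (hwcb : ∀ y, |wc y| ≤ Kc * Real.exp ((pinnedChain ω₂ lam β γ).hamiltonian N y / (8 * T)))
    (hwtb : ∀ y, |wt y| ≤ K' * Real.exp ((pinnedChain ω₂ lam β γ).hamiltonian N y / (8 * T)))
    (hLwa : ∀ x, (pinnedChain ω₂ lam β γ).generator N T T wa x = -v x)
    (hLwc : ∀ x, (pinnedChain ω₂ lam β γ').generator N T T wc x = -v x)
    (hLwt : ∀ x, (pinnedChain ω₂ lam β γ).generator N T T wt x = -v' (x.1, -x.2)) :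
    (∫ x, (Real.sqrt T * partialP ⟨0, by omega⟩ wa x - Real.sqrt T * partialP ⟨0, by omega⟩ wc x) * F'₀ x *
          (pinnedChain ω₂ lam β γ).gibbsDensity N T x) +
        ∫ x, (Real.sqrt T * partialP ⟨N - 1, by omega⟩ wa x - Real.sqrt T * partialP ⟨N - 1, by omega⟩ wc x) *
          F'₁ x * (pinnedChain ω₂ lam β γ).gibbsDensity N T x =
      (γ' - γ) * ((∫ x, (Real.sqrt T * partialP ⟨0, by omega⟩ wc x) *
          (Real.sqrt T * partialP ⟨0, by omega⟩ (fun y : PhaseSpace N => wt (y.1, -y.2)) x) *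
          (pinnedChain ω₂ lam β γ).gibbsDensity N T x) +
        ∫ x, (Real.sqrt T * partialP ⟨N - 1, by omega⟩ wc x) *
          (Real.sqrt T * partialP ⟨N - 1, by omega⟩ (fun y : PhaseSpace N => wt (y.1, -y.2)) x) *
          (pinnedChain ω₂ lam β γ).gibbsDensity N T x) := by
  set P := pinnedChain ω₂ lam β γ with hP
  set ρ := P.gibbsDensity N T with hρ
  set b₀ : Fin N := ⟨0, by omega⟩ with hb₀
  set b₁ : Fin N := ⟨N - 1, by omega⟩ with hb₁
  set w' : PhaseSpace N → ℝ := fun x => wt (x.1, -x.2) with hw'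
  obtain ⟨hvs, -, ⟨Av, hAv, hvb, -⟩, -, -⟩ := adjointField_nice hω hl hβ hN hT γ hF₀ hF₁ hA hb hv
  obtain ⟨hv's, -, ⟨Av', hAv', hv'b, -⟩, -, -⟩ := adjointField_nice hω hl hβ hN hT γ hF'₀ hF'₁ hA' hb' hv'
  obtain ⟨hDa₀, hDa₁, -⟩ := energy_identity hω hl hβ hN hT hγ hF₀ hF₁ hA hb hv hwa hwab hLwa
  obtain ⟨hDc₀, hDc₁, -⟩ := energy_identity hω hl hβ hN hT hγ' hF₀ hF₁ hA hb hv hwc hwcb hLwc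
  obtain ⟨hw's, hw'b, hadjeq, hD'₀, hD'₁, -⟩ :=
    energy_identity_adjoint hω hl hβ hN hT hγ hF'₀ hF'₁ hA' hb' hv' hwt hwtb hLwt
  -- pairings with `v'`
  have hLa := sum_integral_partialP_mul_eq hω hl hβ hN hT γ hF'₀ hF'₁ hA' hb' hv' hwa hwab hDa₀ hDa₁
  have hLc := sum_integral_partialP_mul_eq hω hl hβ hN hT γ hF'₀ hF'₁ hA' hb' hv' hwc hwcb hDc₀ hDc₁
  -- the cross pairings at `(γ, γ)` and `(γ, γ')`
  have hca := cross_pairing hω hl hβ hN hT hγ.le γ (w := wa) (v := v) (w' := w') (v' := v') hwa hw's hvs.continuous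
    hv's.continuous hLwa hadjeq hwab hvb hw'b hv'b hDa₀ hDa₁ hD'₀ hD'₁
  have hcc := cross_pairing hω hl hβ hN hT hγ.le γ' (w := wc) (v := v) (w' := w') (v' := v') hwc hw's hvs.continuous
    hv's.continuous hLwc hadjeq hwcb hvb hw'b hv'b hDc₀ hDc₁ hD'₀ hD'₁
  rw [sub_self, zero_mul, zero_mul, add_zero] at hca
  -- integrability of the four bath pairings (AM–GM)
  have hρ0 : ∀ x, 0 ≤ ρ x := fun x => (P.gibbsDensity_pos N T x).le
  have hρc : Continuous ρ := pinnedChain_continuous_gibbsDensity ω₂ lam β γ N T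
  have iI : ∀ b, Integrable (fun x => (partialP b wa x) ^ 2 * ρ x) → Integrable (fun x => (partialP b wc x) ^ 2 * ρ x) →
      ∀ {G : PhaseSpace N → ℝ}, Continuous G → ∀ {B : ℝ}, 0 ≤ B →
      (∀ y, |G y| ≤ B * Real.exp (P.hamiltonian N y / (16 * T))) →
      Integrable (fun x => (Real.sqrt T * partialP b wa x) * G x * ρ x) ∧
        Integrable (fun x => (Real.sqrt T * partialP b wc x) * G x * ρ x) := by
    intro b ha hc G hG B hB hGb
    have hGb' : ∀ y, |G y| ≤ B * Real.exp (P.hamiltonian N y / (8 * T)) := fun y =>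
      (hGb y).trans (mul_le_mul_of_nonneg_left (Real.exp_le_exp.2 (div_le_div_of_nonneg_left
        (pinnedChain_hamiltonian_nonneg hω.le hl hβ γ N y) (by positivity) (by linarith))) hB)
    have hG2 : Integrable fun x => G x ^ 2 * ρ x := by
      obtain ⟨h, -⟩ := HonestZwanzig.OrthogonalOhmLine.DirichletBound.integrable_weights (N := N) (γ := γ) (w := G)
        (g := G) hω hl hβ hT hG hG hGb' hGb'
      exact h.congr (Eventually.of_forall fun x => by ring)
    have key : ∀ {u : PhaseSpace N → ℝ}, Continuous (partialP b u) → Integrable (fun x => (partialP b u x) ^ 2 * ρ x) →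
        Integrable (fun x => (Real.sqrt T * partialP b u x) * G x * ρ x) := by
      intro u huc hu
      refine Integrable.mono' (((hu.add hG2).div_const 2).const_mul (Real.sqrt T))
        (((continuous_const.mul huc).mul hG).mul hρc).aestronglyMeasurable (Eventually.of_forall fun x => ?_)
      rw [Real.norm_eq_abs, show Real.sqrt T * partialP b u x * G x * ρ x = Real.sqrt T * ((partialP b u x * G x) * ρ x)
        by ring, abs_mul, abs_mul, abs_of_nonneg (Real.sqrt_nonneg T), abs_of_nonneg (hρ0 x)]
      refine mul_le_mul_of_nonneg_left ?_ (Real.sqrt_nonneg T)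
      have : |partialP b u x * G x| ≤ ((partialP b u x) ^ 2 + G x ^ 2) / 2 := by
        rw [abs_le]; constructor <;> nlinarith [sq_nonneg (partialP b u x - G x), sq_nonneg (partialP b u x + G x)]
      calc |partialP b u x * G x| * ρ x ≤ ((partialP b u x) ^ 2 + G x ^ 2) / 2 * ρ x :=
          mul_le_mul_of_nonneg_right this (hρ0 x)
        _ = ((partialP b u x) ^ 2 * ρ x + G x ^ 2 * ρ x) / 2 := by ring
    exact ⟨key (continuous_partialP hwa (by simp) b) ha, key (continuous_partialP hwc (by simp) b) hc⟩
  obtain ⟨ia₀, ic₀⟩ := iI b₀ hDa₀ hDc₀ hF'₀.continuous hA' (fun y => (hb' y).1)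
  obtain ⟨ia₁, ic₁⟩ := iI b₁ hDa₁ hDc₁ hF'₁.continuous hA' (fun y => (hb' y).2.2.1)
  -- split the differences
  have hsplit : (∫ x, (Real.sqrt T * partialP b₀ wa x - Real.sqrt T * partialP b₀ wc x) * F'₀ x * ρ x) +
      ∫ x, (Real.sqrt T * partialP b₁ wa x - Real.sqrt T * partialP b₁ wc x) * F'₁ x * ρ x =
      ((∫ x, (Real.sqrt T * partialP b₀ wa x) * F'₀ x * ρ x) + ∫ x, (Real.sqrt T * partialP b₁ wa x) * F'₁ x * ρ x) -
      ((∫ x, (Real.sqrt T * partialP b₀ wc x) * F'₀ x * ρ x) + ∫ x, (Real.sqrt T * partialP b₁ wc x) * F'₁ x * ρ x) := by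
    have e₀ : ∫ x, (Real.sqrt T * partialP b₀ wa x - Real.sqrt T * partialP b₀ wc x) * F'₀ x * ρ x =
        (∫ x, (Real.sqrt T * partialP b₀ wa x) * F'₀ x * ρ x) - ∫ x, (Real.sqrt T * partialP b₀ wc x) * F'₀ x * ρ x := by
      rw [← integral_sub ia₀ ic₀]
      exact integral_congr_ae (Eventually.of_forall fun x => by ring)
    have e₁ : ∫ x, (Real.sqrt T * partialP b₁ wa x - Real.sqrt T * partialP b₁ wc x) * F'₁ x * ρ x =
        (∫ x, (Real.sqrt T * partialP b₁ wa x) * F'₁ x * ρ x) - ∫ x, (Real.sqrt T * partialP b₁ wc x) * F'₁ x * ρ x := by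
      rw [← integral_sub ia₁ ic₁]
      exact integral_congr_ae (Eventually.of_forall fun x => by ring)
    rw [e₀, e₁]; ring
  rw [hsplit, hLa, hLc, hca, hcc]
  have hsq : ∀ b, ∫ x, (Real.sqrt T * partialP b wc x) * (Real.sqrt T * partialP b w' x) * ρ x =
      T * ∫ x, partialP b w' x * partialP b wc x * ρ x := by
    intro b
    rw [← integral_const_mul]
    refine integral_congr_ae (Eventually.of_forall fun x => ?_)
    have : Real.sqrt T * Real.sqrt T = T := Real.mul_self_sqrt hT.le
    calc Real.sqrt T * partialP b wc x * (Real.sqrt T * partialP b w' x) * ρ x =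
        (Real.sqrt T * Real.sqrt T) * (partialP b w' x * partialP b wc x * ρ x) := by ring
      _ = T * (partialP b w' x * partialP b wc x * ρ x) := by rw [this]
  rw [hsq b₀, hsq b₁]
  ring

end Pinned

end Pencil

/-! ## Registered helper stub -/

open Pencil in
/-- **Registered sub-goal `stub_pencilOfGreenKubo_pairingD`** of the crux (this file's ticket): pairing a Poisson-class function
with a nice field through `D` is pairing with the adjoint field (= `Pencil.sum_integral_partialP_mul_eq`). [folklore] -/
theorem stub_pencilOfGreenKubo_pairingD :
    ∀ (N : ℕ) (ω₂ lam β : ℝ), 0 < ω₂ → 0 ≤ lam → 0 ≤ β → ∀ (hN : 2 ≤ N) (T : ℝ), 0 < T → ∀ (γ : ℝ) (G₀ G₁ u w : Literature.MathematicalPhysics.KineticTheory.HeatConduction.PhaseSpace N → ℝ), ContDiff ℝ ((⊤ : ℕ∞) : WithTop ℕ∞) G₀ → ContDiff ℝ ((⊤ : ℕ∞) : WithTop ℕ∞) G₁ → ∀ (A : ℝ), 0 ≤ A → (∀ y, |G₀ y| ≤ A * Real.exp ((Literature.MathematicalPhysics.KineticTheory.HeatConduction.pinnedChain ω₂ lam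 β γ).hamiltonian N y / (16 * T)) ∧ |Literature.MathematicalPhysics.KineticTheory.HeatConduction.partialP ⟨0, by omega⟩ G₀ y| ≤ A * Real.exp ((Literature.MathematicalPhysics.KineticTheory.HeatConduction.pinnedChain ω₂ lam β γ).hamiltonian N y / (16 * T)) ∧ |G₁ y| ≤ A * Real.exp ((Literature.MathematicalPhysics.KineticTheory.HeatConduction.pinnedChain ω₂ lam β γ).hamiltonian N y / (16 * T)) ∧ |Literature.MathematicalPhysics.KineticTheory.HeatConduction.partialP ⟨N - 1, by omega⟩ G₁ y| ≤ A * Real.exp ((Literature.MathematicalPhysics.KineticTheory.HeatConduction.pinnedChain ω₂ lam β γ).hamiltonian N y / (16 * T))) → (∀ x, u x = Real.sqrt T * (-Literature.MathematicalPhysics.KineticTheory.HeatConduction.partialP ⟨0, by omega⟩ G₀ x + x.2 ⟨0, by omega⟩ * G₀ x / T) + Real.sqrt T * (-Literature.MathematicalPhysics.KineticTheory.HeatConduction.partialP ⟨N - 1, by omega⟩ G₁ x + x.2 ⟨N - 1, by omega⟩ * G₁ x / T)) → ContDiff ℝ ((⊤ : ℕ∞) : WithTop ℕ∞) w → ∀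 (K : ℝ), (∀ y, |w y| ≤ K * Real.exp ((Literature.MathematicalPhysics.KineticTheory.HeatConduction.pinnedChain ω₂ lam β γ).hamiltonian N y / (8 * T))) → MeasureTheory.Integrable (fun x => (Literature.MathematicalPhysics.KineticTheory.HeatConduction.partialP ⟨0, by omega⟩ w x) ^ 2 * (Literature.MathematicalPhysics.KineticTheory.HeatConduction.pinnedChain ω₂ lam β γ).gibbsDensity N T x) → MeasureTheory.Integrable (fun x => (Literature.MathematicalPhysics.KineticTheory.HeatConduction.partialP ⟨N - 1, by omega⟩ w x) ^ 2 * (Literature.MathematicalPhysics.KineticTheory.HeatConduction.pinnedChain ω₂ lam β γ).gibbsDensity N T x) → (∫ x, (Real.sqrt T * Literature.MathematicalPhysics.KineticTheory.HeatConduction.partialP ⟨0, by omega⟩ w x) * G₀ x * (Literature.MathematicalPhysics.KineticTheory.HeatConduction.pinnedChain ω₂ lam β γ).gibbsDensity N T x) + ∫ x, (Real.sqrt T * Literature.MathematicalPhysics.KineticTheory.HeatConduction.partialP ⟨N - 1, by omega⟩ w x) * G₁ x * (Literature.MathematicalPhysics.KineticTheory.HeatConduction.pinnedChain ω₂ lam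 β γ).gibbsDensity N T x = ∫ x, w x * u x * (Literature.MathematicalPhysics.KineticTheory.HeatConduction.pinnedChain ω₂ lam β γ).gibbsDensity N T x :=
  fun _ _ _ _ hω hl hβ hN _ hT γ _ _ _ _ hG₀ hG₁ _ hA hb hu hw _ hwb hD₀ hD₁ =>
    sum_integral_partialP_mul_eq hω hl hβ hN hT γ hG₀ hG₁ hA hb hu hw hwb hD₀ hD₁

end Summit.AtomisticToContinuum.FouriersLaw.Theorems.ContactStieltjesMeasure.CayleyPencil

end
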